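import Literature.NumberTheory.Automorphic.UnitaryGroupHyperbolicSwap
import Literature.NumberTheory.Automorphic.UnitaryGroupNonsplitPlace
import Literature.NumberTheory.Automorphic.UnitaryGroupFrameEmbedding
import Literature.NumberTheory.Automorphic.UnitaryGroupLocalCongr
import Mathlib.LinearAlgebra.CrossProduct
import HarnessLib

/-!
# Rank-3 hermitian forms at a non-split finite place are all similar to the split form `Φ₃ = antidiag(1,1,1)`
# (Witt completion of a hyperbolic pair; the non-split half of `U(H)(F_v) ≃ U(Φ₃)(F_v)`, [Rogawski1990, §14.2 (i)])

Topic `NumberTheory/Automorphic`; namespace `Literature.NumberTheory.Automorphic.UnitaryGroup`.  KERNEL ONLY: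
theorems, no definition, no named fact, no `sorry`.

**Setting.** `E/F` a quadratic extension of number fields with non-trivial automorphism `c`, a `c`-hermitian
`H ∈ M₃(E)` (`(H.map c)ᵀ = H`) with `det H ≠ 0`, a finite place `v` of `F`; `E_v = E ⊗_F F_v = Π_{w ∣ v} E_w` is
the tree's `UnitaryGroup.LocalRing E v` with conjugation `c ⊗ 1 = conjLocal E c v`, and
`U(H)(F_v) = UnitaryGroup.«local» E c 3 H v ≤ GL₃(E_v)` (`UnitaryGroupAutomorphicRep`) is the group the tree's
adelic datum `UnitaryGroup.adelicGroupData` / `cmDatum` carries as `Local v`.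

**Results.**
* §1 (pure algebra, any field `K` with an involution `σ`, [Jacobowitz1962, §3] / [Dieudonne1971GroupesClassiques,
  Chap. II §5]) `exists_formCongr_eq_smul_antidiag_of_hyperbolicPair`: a `σ`-hermitian `H ∈ M₃(K)` with `det H ≠ 0`
  that has a HYPERBOLIC PAIR (`h(r,r) = h(r',r') = 0`, `h(r,r') = 1`, `h = hermForm σ H`) is congruent to a scalar
  multiple of the split form: `∃ T ∈ GL₃(K), a = σ a ≠ 0, ᵗσ(T) · H · T = a • Φ₃`.  The frame is `(a r, u, r')` with
  `u = hermRow r ⨯₃ hermRow r'` the vector orthogonal to the hyperbolic plane (Mathlib `crossProduct`) and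
  `a = h(u,u)` (non-zero by non-degeneracy) — Witt's completion of a hyperbolic pair in rank `3`, written with matrices.
* §2 at a NON-SPLIT place (`w ∣ v`, `c • w = w`, so `E_v` is a field, ★ `LocalRing.isField_of_smul_eq`):
  **`exists_formCongr_map_eq_smul_antidiag_of_smul_eq`** — `ᵗ(c ⊗ 1)(T) · H_v · T = a • Φ₃` for some `T ∈ GL₃(E_v)` and
  a `(c ⊗ 1)`-fixed unit `a ∈ E_v` (the hyperbolic pair is the tree's ★ `exists_isotropic_localGram` — every rank-`≥ 3`
  hermitian space over `E_v` is isotropic, `u(F_v) = 4` — and ★ `exists_hyperbolic_partner_localGram`).  This is the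
  odd-rank local classification «`H_v ≃ a • Φ₃`» ([Jacobowitz1962, Thm. 3.1]: rank and discriminant; the two classes
  differ by a scalar) behind [Rogawski1990, §14.2 p. 232 (i)]: «`G′_v` is isomorphic to `G_v` if `v` is finite and does
  not split in `E`» for the inner forms `G′ = U(H)` of `U(3)` coming from `D = M₃(E)` — `U(a • Φ₃) = U(Φ₃)` is conjugate
  to `U(H_v)` by `T`.  The corollary `exists_isUnit_formCongr_map_eq_smul_antidiag_of_smul_eq` is LITERALLY the
  non-split input `hns` of the tree's ★ `nonempty_cmDatum_local_equiv_antidiag_of_forall_nonsplit_formCongr`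
  (`LocalUnitaryGroupCongr.lean`, which supplies the transport ★ `localFormCongr` and the split places ★
  `localSplitCongr`); together they give `U(H)(F_v) ≃ₜ* U(Φ₃)(F_v)` at EVERY finite place.

`Φ₃` is written `Matrix.of fun i j : Fin 3 => if i.val + j.val + 1 = 3 then 1 else 0` (the inlined form of the
consumers; ★ `antidiagOne_eq_over` identifies it with the tree's `(StdForm.antidiagonal 3).over`); it is preserved
entrywise by ring homomorphisms (private `antidiag_map`).

Written for the cell `hodgecm-mathlib` (ENGINE T1, line `F0_T1InnerFormTraceIdentity`, stub S2
`stub_T1g_locallyQuasiSplit`: the bottom layer `S = ∅` of the local transfer `f′_v ↦ f_v` of [Rogawski1990, §14.2]).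
HC_CM is proved only modulo the printed citations until rung 0 closes; this file is unconditional.

## References
* [Rogawski1990] J. Rogawski, *Automorphic representations of unitary groups in three variables*, Ann. of Math.
  Stud. 123 (1990), §14.2 p. 232 (i)–(iii).
* [Jacobowitz1962] R. Jacobowitz, *Hermitian forms over local fields*, Amer. J. Math. 84 (1962), §3 Thm. 3.1.
* [Dieudonne1971GroupesClassiques] J. Dieudonné, *La géométrie des groupes classiques*, 3e éd. (1971), Chap. II §5.
-/

set_option autoImplicit false

noncomputable section

open Matrix NumberField IsDedekindDomain

namespace Literature.NumberTheory.Automorphic.UnitaryGroup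

/-! ## §1 Rank 3 over a field: a hyperbolic pair completes to a frame in which `H` is `a • Φ₃` -/

section Field

variable {S : Type*} [CommRing S] {n : Type*} [Fintype n] [DecidableEq n]

/-- **Entries of a congruent form are the pairings of the columns of the frame**:
`(ᵗσ(T) H T)ᵢⱼ = h(T eᵢ, T eⱼ)` (★ `hermForm_mulVec_mulVec_eq_hermForm_formCongr` at the basis vectors).
[cite: Dieudonne1971GroupesClassiques, Chap. II §5] -/
theorem formCongr_apply_eq_hermForm_col (σ : S →+* S) (T : GL n S) (H : Matrix n n S) (i j : n) :
    formCongr σ T H i j =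
      hermForm σ H (fun k => (T : Matrix n n S) k i) (fun k => (T : Matrix n n S) k j) := by
  rw [← hermForm_single_single σ (formCongr σ T H) i j, ← hermForm_mulVec_mulVec_eq_hermForm_formCongr,
    Matrix.mulVec_single_one, Matrix.mulVec_single_one]
  rfl

variable {K : Type*} [Field K] (σ : K →+* K) (H : Matrix (Fin 3) (Fin 3) K)

/-- **Witt completion of a hyperbolic pair in rank 3** ([Jacobowitz1962, §3]; [Dieudonne1971GroupesClassiques,
Chap. II §5]): `σ` an involution of the field `K`, `H ∈ M₃(K)` `σ`-hermitian with `det H ≠ 0`, `(r, r')` a hyperbolic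
pair (`h(r,r) = h(r',r') = 0`, `h(r,r') = 1`).  Then `ᵗσ(T) · H · T = a • Φ₃` for some `T ∈ GL₃(K)` and some
`a = σ(a) ≠ 0` — namely the frame `(a r, u, r')`, `u = hermRow r ⨯₃ hermRow r'` spanning the orthogonal complement of
the hyperbolic plane and `a = h(u,u)`. [cite: Jacobowitz1962, §3 Thm. 3.1] -/
theorem exists_formCongr_eq_smul_antidiag_of_hyperbolicPair (hσ : ∀ s, σ (σ s) = s) (hH : (H.map σ)ᵀ = H)
    (hHd : H.det ≠ 0) {r r' : Fin 3 → K} (hr : hermForm σ H r r = 0) (hr' : hermForm σ H r' r' = 0)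
    (hrr' : hermForm σ H r r' = 1) :
    ∃ (T : GL (Fin 3) K) (a : K), a ≠ 0 ∧ σ a = a ∧
      formCongr σ T H = a • Matrix.of fun i j : Fin 3 => if i.val + j.val + 1 = 3 then (1 : K) else 0 := by
  classical
  have hr'r : hermForm σ H r' r = 1 := by rw [← conj_hermForm σ H hσ hH, hrr', map_one]
  -- the vector `u` orthogonal to the hyperbolic plane
  obtain ⟨u, hu_def⟩ : ∃ u : Fin 3 → K, u = crossProduct (hermRow σ H r) (hermRow σ H r') := ⟨_, rfl⟩
  have hru : hermForm σ H r u = 0 := by rw [← hermRow_dotProduct, hu_def]; exact dot_self_cross _ _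
  have hr'u : hermForm σ H r' u = 0 := by rw [← hermRow_dotProduct, hu_def]; exact dot_cross_self _ _
  have hur : hermForm σ H u r = 0 := by rw [← conj_hermForm σ H hσ hH, hru, map_zero]
  have hur' : hermForm σ H u r' = 0 := by rw [← conj_hermForm σ H hσ hH, hr'u, map_zero]
  have hu0 : u ≠ 0 := by
    rw [hu_def]
    refine crossProduct_ne_zero_iff_linearIndependent.2 (LinearIndependent.pair_iff.2 fun s t hst => ?_)
    have h1 := congrArg (fun x => x ⬝ᵥ r') hst
    have h2 := congrArg (fun x => x ⬝ᵥ r) hst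
    simp only [add_dotProduct, smul_dotProduct, hermRow_dotProduct, hrr', hr', hr, hr'r, zero_dotProduct,
      smul_eq_mul, mul_one, mul_zero, add_zero, zero_add] at h1 h2
    exact ⟨h1, h2⟩
  -- the scalar `a = h(u,u)`, fixed by `σ`
  obtain ⟨a, ha_def⟩ : ∃ a : K, a = hermForm σ H u u := ⟨_, rfl⟩
  have hσa : σ a = a := by rw [ha_def]; exact conj_hermForm σ H hσ hH u u
  -- frames `(b r, u, r')`, `b ≠ 0`, are linearly independent
  have key : ∀ b : K, b ≠ 0 → LinearIndependent K ![b • r, u, r'] := by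
    intro b hb
    rw [Fintype.linearIndependent_iff]
    intro g hg
    rw [Fin.sum_univ_three] at hg
    simp only [Matrix.cons_val_zero, Matrix.cons_val_one, Matrix.cons_val_two, Matrix.head_cons,
      Matrix.tail_cons] at hg
    have e1 := congrArg (hermForm σ H r) hg
    have e2 := congrArg (hermForm σ H r') hg
    simp only [hermForm_add_right, hermForm_smul_right, hermForm_zero_right, hr, hru, hrr', hr'r, hr'u, hr',
      mul_zero, mul_one, zero_add, add_zero] at e1 e2
    have hg2 : g 2 = 0 := e1
    have hg0 : g 0 = 0 := by
      rcases mul_eq_zero.1 e2 with h | h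
      · exact h
      · exact absurd h hb
    have hg1 : g 1 = 0 := by
      rw [hg0, hg2, zero_smul, zero_smul, zero_add, add_zero] at hg
      exact (smul_eq_zero.1 hg).resolve_right hu0
    intro i
    fin_cases i
    · exact hg0
    · exact hg1
    · exact hg2
  -- non-degeneracy: `a ≠ 0` (else `h(u, ·)` kills the basis `(r, u, r')`, so `u = 0`)
  have hA1 : IsUnit (Matrix.of ![r, u, r'] : Matrix (Fin 3) (Fin 3) K) := by
    have h1 : LinearIndependent K ![(1 : K) • r, u, r'] := key 1 one_ne_zero
    rw [one_smul] at h1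
    exact Matrix.linearIndependent_rows_iff_isUnit.1 h1
  have ha0 : a ≠ 0 := by
    intro ha
    have hinj := Matrix.mulVec_injective_iff_isUnit.2 hA1
    have hzero : (Matrix.of ![r, u, r'] : Matrix (Fin 3) (Fin 3) K) *ᵥ hermRow σ H u = 0 := by
      funext i
      change ![r, u, r'] i ⬝ᵥ hermRow σ H u = 0
      fin_cases i
      · change r ⬝ᵥ hermRow σ H u = 0
        rw [dotProduct_comm, hermRow_dotProduct, hur]
      · change u ⬝ᵥ hermRow σ H u = 0
        rw [dotProduct_comm, hermRow_dotProduct, ← ha_def, ha]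
      · change r' ⬝ᵥ hermRow σ H u = 0
        rw [dotProduct_comm, hermRow_dotProduct, hur']
    have hrow : hermRow σ H u = 0 := hinj (by rw [hzero, Matrix.mulVec_zero])
    have hHu : IsUnit H := (Matrix.isUnit_iff_isUnit_det H).2 (Ne.isUnit hHd)
    have hσu : (⇑σ ∘ u) = 0 :=
      Matrix.vecMul_injective_iff_isUnit.2 hHu
        (show (⇑σ ∘ u) ᵥ* H = (0 : Fin 3 → K) ᵥ* H by rw [Matrix.zero_vecMul]; exact hrow)
    apply hu0
    funext i
    have hi := congrFun hσu i
    simp only [Function.comp_apply, Pi.zero_apply] at hi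
    have := congrArg σ hi
    rwa [hσ, map_zero] at this
  -- the frame `(a r, u, r')`
  have hA : IsUnit ((Matrix.of ![a • r, u, r'] : Matrix (Fin 3) (Fin 3) K)ᵀ) :=
    (Matrix.isUnit_transpose _).2 (Matrix.linearIndependent_rows_iff_isUnit.1 (key a ha0))
  refine ⟨hA.unit, a, ha0, hσa, ?_⟩
  ext i j
  rw [formCongr_apply_eq_hermForm_col, hA.unit_spec, Matrix.smul_apply, Matrix.of_apply, smul_eq_mul]
  change hermForm σ H (![a • r, u, r'] i) (![a • r, u, r'] j) = _
  fin_cases i <;> fin_cases j <;>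
    simp [hermForm_smul_left_eq, hermForm_smul_right, hr, hr', hrr', hr'r, hru, hr'u, hur, hur', hσa, ← ha_def]

/-- The split form `Φ_N = antidiag(1, …, 1)`, written `(i, j) ↦ [i + j + 1 = N]`, is preserved entrywise by every ring
homomorphism (entries `0`, `1`). [folklore] -/
private theorem antidiag_map {R R' : Type*} [NonAssocSemiring R] [NonAssocSemiring R'] (f : R →+* R') (N : ℕ) :
    (Matrix.of fun i j : Fin N => if i.val + j.val + 1 = N then (1 : R) else 0).map f =
      Matrix.of fun i j : Fin N => if i.val + j.val + 1 = N then (1 : R') else 0 := by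
  ext i j
  simp only [Matrix.map_apply, Matrix.of_apply, apply_ite f, map_one, map_zero]

end Field

/-! ## §2 At a non-split place: `H_v ≃ a • Φ₃` -/

section Local

variable {F : Type} [Field F] [NumberField F] (E : Type) [Field E] [NumberField E] [Algebra F E]
  [Algebra.IsQuadraticExtension F E] (c : E ≃ₐ[F] E)

omit [NumberField E] in
/-- In a quadratic extension `E/F` with `c ≠ 1` there is `δ` with `c δ = -δ ≠ 0` (`δ = e - c e` for any `e` moved by
`c`; `c² = 1`) — the parameter of the tree's place-wise isotropy theorems. [folklore] -/
private theorem exists_apply_eq_neg_ne_zero (hc : c ≠ 1) : ∃ δ : E, c δ = -δ ∧ δ ≠ 0 := by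
  -- as in `QuadraticForms/HermitianLocalIsotropy` (private there)
  haveI : FiniteDimensional F E :=
    Module.finite_of_finrank_eq_succ (Algebra.IsQuadraticExtension.finrank_eq_two F E)
  haveI : PerfectField F := inferInstance
  haveI : Algebra.IsAlgebraic F E := inferInstance
  haveI : Algebra.IsSeparable F E := inferInstance
  obtain ⟨e, he⟩ : ∃ e : E, c e ≠ e := by
    by_contra h
    push Not at h
    exact hc (AlgEquiv.ext h)
  refine ⟨e - c e, ?_, sub_ne_zero.mpr (Ne.symm he)⟩
  rw [map_sub, neg_sub, ← AlgEquiv.mul_apply, algEquiv_mul_self_eq_one F hc, AlgEquiv.one_apply]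

/-- **At a non-split place a rank-3 hermitian form is a scalar multiple of the split form** ([Rogawski1990, §14.2
p. 232 (i)]; [Jacobowitz1962, Thm. 3.1]): `c ≠ 1`, `H ∈ M₃(E)` `c`-hermitian with `det H ≠ 0`, `w ∣ v` with
`c • w = w`; then `ᵗ(c ⊗ 1)(T) · H_v · T = a • (Φ₃)_v` over `E_v = E ⊗_F F_v` for some `T ∈ GL₃(E_v)` and a
`(c ⊗ 1)`-fixed unit `a ∈ E_v` (`E_v` is a field, ★ `LocalRing.isField_of_smul_eq`; hyperbolic pair by ★
`exists_isotropic_localGram` + ★ `exists_hyperbolic_partner_localGram`; then §1).  `H_v`, `(Φ₃)_v` are written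
`·.map (algebraMap E E_v)` (= the defining matrices `(adelicForm E 3 ·).map (adeleToLocal E v)` of the local unitary
groups, ★ `adelicForm_map_adeleToLocal`). [cite: Rogawski1990, §14.2 p. 232] -/
theorem exists_formCongr_map_eq_smul_antidiag_of_smul_eq (hc : c ≠ 1) (H : Matrix (Fin 3) (Fin 3) E)
    (hHh : (H.map c)ᵀ = H) (hHd : H.det ≠ 0) {v : HeightOneSpectrum (𝓞 F)} (w : PlacesOver E v)
    (hw : c • w.1 = w.1) :
    ∃ (T : GL (Fin 3) (LocalRing E v)) (a : LocalRing E v), IsUnit a ∧ conjLocal E c v a = a ∧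
      formCongr (conjLocal E c v) T (H.map (algebraMap E (LocalRing E v))) =
        a • (Matrix.of fun i j : Fin 3 => if i.val + j.val + 1 = 3 then (1 : E) else 0).map
          (algebraMap E (LocalRing E v)) := by
  have hE : IsField (LocalRing E v) := LocalRing.isField_of_smul_eq c hc w hw
  obtain ⟨δ, hcδ, hδ⟩ := exists_apply_eq_neg_ne_zero E c hc
  obtain ⟨r, hr0, hr⟩ := exists_isotropic_localGram E c 3 H v hcδ hδ le_rfl hHh hHd
  obtain ⟨r', hr', hrr'⟩ := exists_hyperbolic_partner_localGram E c 3 H v hcδ hδ hE hHh hHd hr hr0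
  rw [adelicForm_map_adeleToLocal] at hr hr' hrr'
  have hHv : ((H.map (algebraMap E (LocalRing E v))).map (conjLocal E c v))ᵀ = H.map (algebraMap E (LocalRing E v)) := by
    rw [← adelicForm_map_adeleToLocal]; exact Liu2021.LemD1OfPlace.localGram_hermitian E v c 3 H hHh
  have hHvd : (H.map (algebraMap E (LocalRing E v))).det ≠ 0 := by
    rw [← adelicForm_map_adeleToLocal]; exact (Liu2021.LemD1OfPlace.isUnit_det_localGram E v 3 H hHd).ne_zero
  letI : Field (LocalRing E v) := hE.toField
  obtain ⟨T, a, ha0, hσa, hT⟩ := exists_formCongr_eq_smul_antidiag_of_hyperbolicPair (conjLocal E c v)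
    (H.map (algebraMap E (LocalRing E v))) (Liu2021.LemD1OfPlace.conjLocal_conjLocal_apply E v c hcδ hδ)
    hHv hHvd hr hr' hrr'
  exact ⟨T, a, IsUnit.mk0 a ha0, hσa, by rw [hT, antidiag_map]⟩

/-- **The non-split input of the quasi-split comparison, in the tree's binders**: the hypothesis `hns` of ★
`nonempty_cmDatum_local_equiv_antidiag_of_forall_nonsplit_formCongr` (`LocalUnitaryGroupCongr.lean`) at `N = 3`,
verbatim — `∃ T a, IsUnit a ∧ ᵗ(c ⊗ 1)(T) · H_v · T = a • (Φ₃)_v` at every non-split `(v, w)`. With that theorem: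
`U(H)(F_v) ≃ₜ* U(Φ₃)(F_v)` at every finite place ([Rogawski1990, §14.2 p. 232 (i)–(iii)], `D = M₃(E)`).
[cite: Rogawski1990, §14.2 p. 232] -/
theorem exists_isUnit_formCongr_map_eq_smul_antidiag_of_smul_eq (hc : c ≠ 1) (H : Matrix (Fin 3) (Fin 3) E)
    (hHh : (H.map c)ᵀ = H) (hHd : H.det ≠ 0) {v : HeightOneSpectrum (𝓞 F)} (w : PlacesOver E v)
    (hw : c • w.1 = w.1) :
    ∃ (T : GL (Fin 3) (LocalRing E v)) (a : LocalRing E v), IsUnit a ∧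
      formCongr (conjLocal E c v) T (H.map (algebraMap E (LocalRing E v))) =
        a • (Matrix.of fun i j : Fin 3 => if i.val + j.val + 1 = 3 then (1 : E) else 0).map
          (algebraMap E (LocalRing E v)) := by
  obtain ⟨T, a, ha, -, hT⟩ := exists_formCongr_map_eq_smul_antidiag_of_smul_eq E c hc H hHh hHd w hw
  exact ⟨T, a, ha, hT⟩

end Local

end Literature.NumberTheory.Automorphic.UnitaryGroup

end
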